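import Literature.MathematicalPhysics.QuantumFieldTheory.Balaban1983to89.B9Ineq349SiteFromPinsPairM
import Literature.MathematicalPhysics.QuantumFieldTheory.Balaban1983to89.B9Ineq349SiteFromBlocksR

/-!
# `Balaban1983to89.B9Ineq349SiteSchemasR` — T. Bałaban, *Propagators for lattice gauge theories in a background field*, Commun. Math. Phys. **99** (1985)
# 389–434 [Balaban1985BackgroundPropagators], (3.49) p. 399 ⇐ Thm 3.1 (3.42) p. 397 + Thm 3.2 (3.48) p. 398: ROW 25's INPUT SCHEMAS RE-PRESSED ONCE OVER THE
# CLASS-PARAMETRIC CARRIER `bg9YR 𝔸 G R₁ R₂` (CASCADE-R STEP 2, n06-i share; the R-twins of the plumbing below `B9Ineq349SiteFacesAtLetters`: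
# `B9Ineq349SiteFromConv342.majorants_of_thm37Printed ∕ thm31LeftSchema_of_majorants`, `B9Ineq349SiteFromPinsPairM.majorants342_of_t37_pairM ∕
# thm31LeftSchema_of_t37_pairM ∕ majorants348_of_display348 ∕ thm32BlkSchema_of_display348`, `B9Ineq349SiteFromConv348.thm32BlkSchema_of_majorants`,
# `B9Ineq349SiteAdjoint.thm31SiteSchemas_of_left`, `B9Ineq349SiteFacesAtLetters.thm31LeftSchemaSymm_of_std`)

[4] = T. Bałaban, *Propagators and renormalization transformations for lattice gauge theories. II*, Commun. Math. Phys. **96** (1984) 223–250 [`Balaban1984PropagatorsII`].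

statement-level skeleton of published theorems with citation tags; proofs where landed; nothing here is a claim about the Yang–Mills mass gap

THE PRINT.  [B9] p. 399: *«Let us consider the operator P = I − R. We have ∇_U P_U = −∇_U R_U, hence using again Lemma 2.1 of [4] we get (3.49)»*; p. 397 Thm 3.1
(3.42) (*«M ≥ M₁, 0 < α₀, Mα₀ ≤ a₀, U in (3.35)»*); p. 398 Thm 3.2 (3.48); p. 410 *«Theorem 3.7 implies that all the inequalities (3.42)–(3.47) hold for G′»*;
p. 413 *«This theorem [3.9] implies Theorem 3.2»*; p. 394 (3.25) (`Δ′_a(U)` symmetric positive); p. 396 (3.35) *«U with values in G»*.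

WHY THIS FILE (dag-n06-i gen 21; dag-n06-d g12 STEP-3 FACE CENSUS 2026-08-28 «`s349_site_of_t37_display348_of` [n06-i]: `bg9Y`-PINNED ✗, R-twin = object
re-typing + `MemOfFam`»; node00-def-Y g23 RULING-2 (α1), per-face rule (b)).  Row 25's knit face derives the printed (3.49) from ROW 18's Theorem-3.7 leaf `t37`
and ROWS 15–16's one display `h348` through four schema layers; the last layer is already re-pressed (`B9Ineq349SiteFromBlocksR`: `Thm31SiteSchemasR`,
`Thm32BlkSchemaR`, `stmt349Printed_site_of_blockSchemas_R`).  This file re-presses the layers in between: the walk-model objects (`𝔬 : B9Thm37Whole.Ops (geo9Y x)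
(bg9YR … x) …`, `rd`, `K`, the `PairM` E-letter at `bg := bg9YR …`) and the premises are read at the carrier (its (3.35) IS the parameter `R₁`, `Iff.rfl`); the ONE
class read — `G`-valuedness `hU.1.1` (contractive ∕ unitary transporters, the symmetry of `G′(U)`) — is DISPLAYED as def-Y's `MemOfFam G R₁`; the LEFT ∕ LEFT-SYMM
schemas (definitions pinned at `bg9Y` in `B9Ineq349SiteAdjoint`) are written UNFOLDED at the carrier (no new definition); proof texts otherwise verbatim.

WHAT IS PROVED (sorry-free, 0 def).
* §1 `majorants_of_thm37Printed_R`, `majorants342_of_t37_pairM_R` (generic `𝔸`, `G`; class-blind) — the two sup majorants of `GcoS … (𝔏 x).Gp U`,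
  `DcoS ∘ GcoS` under Theorem 3.7's prefix at the carrier, from the leaf on the `PairM` E-letter at the site pins.
* §2 ★ `thm31LeftSchemaR_of_majorants (hG : G ≤ U(N)) (hGR : MemOfFam G R₁) …`, `thm31LeftSchemaR_of_t37_pairM` (`𝔸 = M_N(ℂ)`) — the LEFT (3.42) schema AT
  THE CARRIER (unfolded), constant `max(1, mN·C·e^{2δ})`.
* §3 ★ `thm31LeftSchemaSymmR_of_std (hGR) (hparS hGp)` (the symmetry ∕ transport conjuncts for the standard `parS ∕ Gp`), ★★ `thm31SiteSchemasR_of_leftSymm (hGR)`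
  (`Thm31SiteSchemasR (M_N(ℂ)) G c35 𝔏 R₁ R₂` from the unfolded LEFT-SYMM schema; adjoint side = `right342At_of_left342At`).
* §4 `thm32BlkSchemaR_of_majorants` (generic finite-dimensional `𝔸`; class-blind), `majorants348_of_display348_R`, ★★ `thm32BlkSchemaR_of_display348` —
  `Thm32BlkSchemaR (M_N(ℂ)) SU(N) c35 𝔏 R₁ R₂` from ROWS 15–16's one display `h348` premised on the carrier's (3.35).

HONEST SCOPE.  Re-typing bookkeeping (CASCADE-R STEP 2) of LANDED derivations; the (3.35) class is a PARAMETER; the one class fact used is a displayed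
hypothesis; Theorem 3.7's leaf and the (3.48)⁻¹ display remain ROWS 18 ∕ 15–16's hypotheses; nothing of [B9] or [4] is asserted; count-neutral; N06 NOT
discharged; one finite 𝕋^{d+1} programme at fixed ε — nothing continuum, nothing OS, nothing about the mass gap.  Cell `pub-ymgap` (HUMAN RULING D-0062), Track A
node N06 [B9], seat `pub-ymgap-dag-n06-i` (gen 21), 2026-08-28; a NEW file (APPEND-ONLY companion of the five named files, untouched).
-/

noncomputable section

namespace Literature.MathematicalPhysics.QuantumFieldTheory.Balaban1983to89.B9Ineq349SiteSchemasR

open B6RandomWalk (HasMajorant)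
open B6RandomWalkHom (HasMajorantHom)
open B6GlobalChartV1 (blkV1)
open B6Ineq2142KLevelV1 (lvl β)
open B9Thm34Ext (toB6)
open B9Thm37Whole (Ops Conv342)
open B9Cor38Whole (WalkReading)
open B9Thm39WholeBlk (Conv348Blk)
open B9Thm39ReadingCoords (cR39)
open B9Thm39ReadingAtLetters (κ39 basis39 X39 L39)
open B9Thm39OneCubeReadingAtLettersY (oneCubeOps39YF)
open B9CoReadingCoordsS (XSK blkSK sIK GcoS DcoS)
open B9Ineq349SiteComposite (lenB lenB_pos Left342At Right342At Blk348At)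
open B9Ineq349SiteFromBlocksR (Thm31SiteSchemasR Thm32BlkSchemaR)
open B9Ineq349SiteAdjoint (right342At_of_left342At isSymmTr_GpY_parSymY)
open B9Ineq349SiteFromConv342 (left342At_of_hasMajorants left342At_mono contractive_of_mem)
open B9Ineq349SiteFromConv348 (blk39F blk348At_of_hasMajorant blk348At_mono)
open B9Thm311ReadingCoords (IsSymmTr)
open B9RWSumsDefinitePins (PinPrims)
open B9RWSumsDefinitePinsPair (PairPrims)
open B9RWSumsDefinitePinsPairM (MixedPrims E37YPairM)
open B7Prop2SpecialUnitary (specialUnitaryUnits specialUnitaryUnits_le_unitaryUnits)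
open B9PinMembersKLevelV1 (MemberY geo9Y bg9Y)
open B9BackgroundsKLevelV1R (RegFamY bg9YR MemOfFam mem_of_reg335R)
open B9RWSumsReadsNbr (nbr)
open Node00
open scoped Matrix.Norms.L2Operator

/-! ## §1 The two sup majorants of Theorem 3.7 at the site pins, at the class-parametric carrier (class-blind) -/

section Majorants37

variable {𝔸 : Type} [NormedRing 𝔸] [NormedAlgebra ℂ 𝔸] [CompleteSpace 𝔸] [FiniteDimensional ℝ 𝔸] {G : Subgroup 𝔸ˣ}
variable {κ : Type} [Fintype κ] [DecidableEq κ]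
variable {d ℓ : ℕ} {hd : 1 ≤ d + 1} {hL : Odd (ℓ + 1) ∧ 1 < ℓ + 1} {b₀ b₁ : ℝ} {Mstar : ℕ}
variable [∀ x : MemberY d ℓ hd hL b₀ b₁ Mstar, Fintype (geo9Y x).Site]
variable (R₁ R₂ : RegFamY d ℓ hd hL b₀ b₁ Mstar 𝔸)

omit [DecidableEq κ] in
/-- ★ **FROM THE LEAF OF THEOREM 3.7 TO THE TWO MAJORANTS AT THE SITE PINS, AT THE CLASS-PARAMETRIC CARRIER** — the R-twin of
`B9Ineq349SiteFromConv342.majorants_of_thm37Printed` (same proof text; walk letters `𝔬 x : Ops (geo9Y x) (bg9YR 𝔸 G R₁ R₂ x) …`, expansion data and the leaf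
`B9.Thm37Printed c35 geo9Y (bg9YR …) E` at the carrier; class-blind).
[cite: Balaban1985BackgroundPropagators, Thm 3.7 p.409 + «Theorem 3.7 implies (3.42)–(3.47)» p.410, (3.35) p.396 (the class as a parameter)] -/
theorem majorants_of_thm37Printed_R (b : Module.Basis κ ℝ 𝔸) {c35 : ℝ} (𝔏 : ∀ x : MemberY d ℓ hd hL b₀ b₁ Mstar, CovLettersY 𝔸 x)
    {ι : MemberY d ℓ hd hL b₀ b₁ Mstar → Type}
    (𝔬 : ∀ x : MemberY d ℓ hd hL b₀ b₁ Mstar, Ops (geo9Y x) (bg9YR 𝔸 G R₁ R₂ x) (XSK κ x.toKIdx) (XSK κ x.toKIdx) (ι x))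
    (E : ∀ x : MemberY d ℓ hd hL b₀ b₁ Mstar, B9.RWExpansion (geo9Y x) (bg9YR 𝔸 G R₁ R₂ x))
    (t37 : B9.Thm37Printed c35 (fun x : MemberY d ℓ hd hL b₀ b₁ Mstar => geo9Y x) (fun x => bg9YR 𝔸 G R₁ R₂ x) E)
    {R : MemberY d ℓ hd hL b₀ b₁ Mstar → ℝ} {H : MemberY d ℓ hd hL b₀ b₁ Mstar → Prop} {C δ : ℝ} (hC : 0 ≤ C) (hδ : 0 < δ)
    (hconv : ∀ (x : MemberY d ℓ hd hL b₀ b₁ Mstar) (U : (bg9YR 𝔸 G R₁ R₂ x).Cfg), (E x).Converges U → Conv342 (𝔬 x) (R x) (H x) C δ U)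
    {bI : ∀ x : MemberY d ℓ hd hL b₀ b₁ Mstar, FBondY x.toKIdx → IBondY x.toKIdx}
    (hblkS : ∀ x : MemberY d ℓ hd hL b₀ b₁ Mstar, (𝔬 x).blk = blkSK x.toKIdx (sIK x.toKIdx (bI x)))
    (hblkYS : ∀ x : MemberY d ℓ hd hL b₀ b₁ Mstar, (𝔬 x).blkY = blkSK x.toKIdx (sIK x.toKIdx (bI x)))
    (hGpS : ∀ (x : MemberY d ℓ hd hL b₀ b₁ Mstar) (U : (bg9YR 𝔸 G R₁ R₂ x).Cfg), (𝔬 x).Gp U = GcoS x.toKIdx b (bg9YR 𝔸 G R₁ R₂ x) (fun U => U) (𝔏 x).Gp U)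
    (hDS : ∀ (x : MemberY d ℓ hd hL b₀ b₁ Mstar) (U : (bg9YR 𝔸 G R₁ R₂ x).Cfg), (𝔬 x).D U = DcoS x.toKIdx b (bg9YR 𝔸 G R₁ R₂ x) (fun U => U) U) :
    ∃ M₂ a₀ C δ : ℝ, 0 < M₂ ∧ 0 < a₀ ∧ 0 ≤ C ∧ 0 < δ ∧
      ∀ x : MemberY d ℓ hd hL b₀ b₁ Mstar, M₂ ≤ (geo9Y x).M → ∀ α₀ : ℝ, 0 < α₀ → (geo9Y x).M * α₀ ≤ a₀ →
        ∀ U : (bg9YR 𝔸 G R₁ R₂ x).Cfg, (bg9YR 𝔸 G R₁ R₂ x).Reg335 c35 α₀ U →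
          HasMajorant (g := toB6 (geo9Y x) (R x) (H x)) (blkSK x.toKIdx (sIK x.toKIdx (bI x)))
              (GcoS x.toKIdx b (bg9YR 𝔸 G R₁ R₂ x) (fun U => U) (𝔏 x).Gp U)
              (fun a a' => C * (geo9Y x).len a ^ 2 * Real.exp (-(δ * (geo9Y x).dist a a'))) ∧
            HasMajorantHom (g := toB6 (geo9Y x) (R x) (H x)) (blkSK x.toKIdx (sIK x.toKIdx (bI x))) (blkSK x.toKIdx (sIK x.toKIdx (bI x)))
              (DcoS x.toKIdx b (bg9YR 𝔸 G R₁ R₂ x) (fun U => U) U ∘ₗ GcoS x.toKIdx b (bg9YR 𝔸 G R₁ R₂ x) (fun U => U) (𝔏 x).Gp U)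
              (fun a a' => C * (geo9Y x).len a * Real.exp (-(δ * (geo9Y x).dist a a'))) := by
  obtain ⟨M₂, a₀, hM₂, ha₀, H37⟩ := t37
  refine ⟨M₂, a₀, C, δ, hM₂, ha₀, hC, hδ, fun x hM α₀ hα₀ hMa U hU => ?_⟩
  obtain ⟨h0, h1, -, -⟩ := hconv x U (H37 x hM α₀ hα₀ hMa U hU)
  rw [hblkS x, hGpS x U] at h0
  rw [hblkS x, hblkYS x, hGpS x U, hDS x U] at h1
  exact ⟨h0, h1⟩

omit [DecidableEq κ] in
/-- **THE TWO SUP MAJORANTS OF THEOREM 3.7 AT THE SITE PINS FROM THE LEAF ON THE `PairM` E-LETTER, AT THE CLASS-PARAMETRIC CARRIER** — the R-twin of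
`B9Ineq349SiteFromPinsPairM.majorants342_of_t37_pairM` (`E37YPairM (bg := bg9YR 𝔸 G R₁ R₂) …`, whose convergence predicate has first conjunct `Conv342 …`; class-blind).
[cite: Balaban1985BackgroundPropagators, Thm 3.7 p.409 + «Theorem 3.7 implies (3.42)–(3.47)» p.410, (3.35) p.396] -/
theorem majorants342_of_t37_pairM_R (b : Module.Basis κ ℝ 𝔸) {c35 : ℝ}
    (𝔏 : ∀ x : MemberY d ℓ hd hL b₀ b₁ Mstar, CovLettersY 𝔸 x) {ι : MemberY d ℓ hd hL b₀ b₁ Mstar → Type}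
    (𝔬 : ∀ x : MemberY d ℓ hd hL b₀ b₁ Mstar, Ops (geo9Y x) (bg9YR 𝔸 G R₁ R₂ x) (XSK κ x.toKIdx) (XSK κ x.toKIdx) (ι x))
    (rd : ∀ x : MemberY d ℓ hd hL b₀ b₁ Mstar, WalkReading (geo9Y x) (bg9YR 𝔸 G R₁ R₂ x) (XSK κ x.toKIdx) (ι x))
    (H : MemberY d ℓ hd hL b₀ b₁ Mstar → Prop) {m mN' : ℕ} {Cev NQ : ℝ} {p q : PinPrims} (hp : p.OK) {p3 q3 : PairPrims} {pM qM : MixedPrims}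
    {K : ∀ x : MemberY d ℓ hd hL b₀ b₁ Mstar, B9.KernelFamily (geo9Y x) (bg9YR 𝔸 G R₁ R₂ x)}
    (t37 : B9.Thm37Printed c35 (fun x : MemberY d ℓ hd hL b₀ b₁ Mstar => geo9Y x) (fun x => bg9YR 𝔸 G R₁ R₂ x)
      (fun x => E37YPairM (bg := bg9YR 𝔸 G R₁ R₂) m mN' Cev NQ p q p3 q3 pM qM (𝔬 x) (rd x) (H x) (K x)))
    {bI : ∀ x : MemberY d ℓ hd hL b₀ b₁ Mstar, FBondY x.toKIdx → IBondY x.toKIdx}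
    (hblkS : ∀ x : MemberY d ℓ hd hL b₀ b₁ Mstar, (𝔬 x).blk = blkSK x.toKIdx (sIK x.toKIdx (bI x)))
    (hblkYS : ∀ x : MemberY d ℓ hd hL b₀ b₁ Mstar, (𝔬 x).blkY = blkSK x.toKIdx (sIK x.toKIdx (bI x)))
    (hGpS : ∀ (x : MemberY d ℓ hd hL b₀ b₁ Mstar) (U : (bg9YR 𝔸 G R₁ R₂ x).Cfg), (𝔬 x).Gp U = GcoS x.toKIdx b (bg9YR 𝔸 G R₁ R₂ x) (fun U => U) (𝔏 x).Gp U)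
    (hDS : ∀ (x : MemberY d ℓ hd hL b₀ b₁ Mstar) (U : (bg9YR 𝔸 G R₁ R₂ x).Cfg), (𝔬 x).D U = DcoS x.toKIdx b (bg9YR 𝔸 G R₁ R₂ x) (fun U => U) U) :
    ∃ M₂ a₀ C δ : ℝ, 0 < M₂ ∧ 0 < a₀ ∧ 0 ≤ C ∧ 0 < δ ∧
      ∀ x : MemberY d ℓ hd hL b₀ b₁ Mstar, M₂ ≤ (geo9Y x).M → ∀ α₀ : ℝ, 0 < α₀ → (geo9Y x).M * α₀ ≤ a₀ →
        ∀ U : (bg9YR 𝔸 G R₁ R₂ x).Cfg, (bg9YR 𝔸 G R₁ R₂ x).Reg335 c35 α₀ U →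
          HasMajorant (g := toB6 (geo9Y x) ((fun _ : MemberY d ℓ hd hL b₀ b₁ Mstar => (1 : ℝ)) x) (H x)) (blkSK x.toKIdx (sIK x.toKIdx (bI x)))
              (GcoS x.toKIdx b (bg9YR 𝔸 G R₁ R₂ x) (fun U => U) (𝔏 x).Gp U)
              (fun a a' => C * (geo9Y x).len a ^ 2 * Real.exp (-(δ * (geo9Y x).dist a a'))) ∧
            HasMajorantHom (g := toB6 (geo9Y x) ((fun _ : MemberY d ℓ hd hL b₀ b₁ Mstar => (1 : ℝ)) x) (H x))
              (blkSK x.toKIdx (sIK x.toKIdx (bI x))) (blkSK x.toKIdx (sIK x.toKIdx (bI x)))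
              (DcoS x.toKIdx b (bg9YR 𝔸 G R₁ R₂ x) (fun U => U) U ∘ₗ GcoS x.toKIdx b (bg9YR 𝔸 G R₁ R₂ x) (fun U => U) (𝔏 x).Gp U)
              (fun a a' => C * (geo9Y x).len a * Real.exp (-(δ * (geo9Y x).dist a a'))) :=
  majorants_of_thm37Printed_R R₁ R₂ (R := fun _ => (1 : ℝ)) b 𝔏 𝔬 _ t37 (p.C_nonneg hp _) (PinPrims.rate_pos hp)
    (fun _ _ h => h.1) hblkS hblkYS hGpS hDS

end Majorants37

/-! ## §2 ★ The LEFT (3.42) schema of (3.49) at the carrier (`𝔸 = M_N(ℂ)`, `G ≤ U(N)`, `MemOfFam G R₁` displayed) -/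

section Left

variable {N : ℕ} {G : Subgroup (Matrix (Fin N) (Fin N) ℂ)ˣ} {κ : Type} [Fintype κ] [DecidableEq κ]
variable {d ℓ : ℕ} {hd : 1 ≤ d + 1} {hL : Odd (ℓ + 1) ∧ 1 < ℓ + 1} {b₀ b₁ : ℝ} {Mstar : ℕ}
variable [∀ x : MemberY d ℓ hd hL b₀ b₁ Mstar, Fintype (geo9Y x).Site]
variable (R₁ R₂ : RegFamY d ℓ hd hL b₀ b₁ Mstar (Matrix (Fin N) (Fin N) ℂ))

/-- ★ **THE LEFT (3.42) SCHEMA AT THE CLASS-PARAMETRIC CARRIER FROM THE TWO SUP MAJORANTS AT THE SITE PINS** — the R-twin of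
`B9Ineq349SiteFromConv342.thm31LeftSchema_of_majorants`, its conclusion `Thm31LeftSchema` written UNFOLDED at the carrier (the landed definition is pinned at
`bg9Y`); the one class read (`G`-valuedness of `U`, for contractive site transporters) is the displayed `hGR : MemOfFam G R₁`; constant `max(1, mN·C·e^{2δ})`.
[cite: Balaban1985BackgroundPropagators, Thm 3.1 (3.42) p.397 ⇐ Thm 3.7 p.410; (3.25) p.394, (3.35) p.396] -/
theorem thm31LeftSchemaR_of_majorants (hG : G ≤ B7Prop2Explicit.unitaryUnits (Matrix (Fin N) (Fin N) ℂ)) (hGR : MemOfFam G R₁)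
    (b : Module.Basis κ ℝ (Matrix (Fin N) (Fin N) ℂ)) {c35 : ℝ} (𝔏 : ∀ x : MemberY d ℓ hd hL b₀ b₁ Mstar, CovLettersY (Matrix (Fin N) (Fin N) ℂ) x)
    (hparG : ∀ (x : MemberY d ℓ hd hL b₀ b₁ Mstar) (U : CfgY (Matrix (Fin N) (Fin N) ℂ) x.toKIdx), (∀ μ y, U μ y ∈ G) →
      ∀ z w : SiteY x.toKIdx, (𝔏 x).parS U z w ∈ G)
    {bI : ∀ x : MemberY d ℓ hd hL b₀ b₁ Mstar, FBondY x.toKIdx → IBondY x.toKIdx}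
    (hlev : ∀ (x : MemberY d ℓ hd hL b₀ b₁ Mstar) (f : FBondY x.toKIdx), lvl x.hN x.D x.hk (bI x f) = (blkV1 x.hN x.D f).1.1)
    (hβ1 : ∀ (x : MemberY d ℓ hd hL b₀ b₁ Mstar) (f : FBondY x.toKIdx), (B6Geom246MultiLevelTorus.geomT x.D).dist (β x.hN x.D x.hk (bI x f)) (blkV1 x.hN x.D f) ≤ 1)
    {mN : ℕ} (hnbr : ∀ (x : MemberY d ℓ hd hL b₀ b₁ Mstar) (y : (geo9Y x).Site), (nbr (geo9Y x) 2 y).card ≤ mN)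
    {R : MemberY d ℓ hd hL b₀ b₁ Mstar → ℝ} {H : MemberY d ℓ hd hL b₀ b₁ Mstar → Prop}
    (h : ∃ M₂ a₀ C δ : ℝ, 0 < M₂ ∧ 0 < a₀ ∧ 0 ≤ C ∧ 0 < δ ∧
      ∀ x : MemberY d ℓ hd hL b₀ b₁ Mstar, M₂ ≤ (geo9Y x).M → ∀ α₀ : ℝ, 0 < α₀ → (geo9Y x).M * α₀ ≤ a₀ →
        ∀ U : (bg9YR (Matrix (Fin N) (Fin N) ℂ) G R₁ R₂ x).Cfg, (bg9YR (Matrix (Fin N) (Fin N) ℂ) G R₁ R₂ x).Reg335 c35 α₀ U →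
          HasMajorant (g := toB6 (geo9Y x) (R x) (H x)) (blkSK x.toKIdx (sIK x.toKIdx (bI x)))
              (GcoS x.toKIdx b (bg9YR (Matrix (Fin N) (Fin N) ℂ) G R₁ R₂ x) (fun U => U) (𝔏 x).Gp U)
              (fun a a' => C * (geo9Y x).len a ^ 2 * Real.exp (-(δ * (geo9Y x).dist a a'))) ∧
            HasMajorantHom (g := toB6 (geo9Y x) (R x) (H x)) (blkSK x.toKIdx (sIK x.toKIdx (bI x))) (blkSK x.toKIdx (sIK x.toKIdx (bI x)))
              (DcoS x.toKIdx b (bg9YR (Matrix (Fin N) (Fin N) ℂ) G R₁ R₂ x) (fun U => U) U ∘ₗ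
                GcoS x.toKIdx b (bg9YR (Matrix (Fin N) (Fin N) ℂ) G R₁ R₂ x) (fun U => U) (𝔏 x).Gp U)
              (fun a a' => C * (geo9Y x).len a * Real.exp (-(δ * (geo9Y x).dist a a')))) :
    ∃ M₁ δ₀ a₀ B₀ : ℝ, 0 < M₁ ∧ 0 < δ₀ ∧ 0 < a₀ ∧ 0 < B₀ ∧
      ∀ x : MemberY d ℓ hd hL b₀ b₁ Mstar, M₁ ≤ (geo9Y x).M → ∀ α₀ : ℝ, 0 < α₀ → (geo9Y x).M * α₀ ≤ a₀ →
        ∀ U : (bg9YR (Matrix (Fin N) (Fin N) ℂ) G R₁ R₂ x).Cfg, (bg9YR (Matrix (Fin N) (Fin N) ℂ) G R₁ R₂ x).Reg335 c35 α₀ U →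
          Left342At x.toKIdx (𝔏 x).parS (𝔏 x).Gp U B₀ δ₀ := by
  obtain ⟨M₂, a₀, C, δ, hM₂, ha₀, hC, hδ, hmaj⟩ := h
  refine ⟨M₂, δ, a₀, max 1 (mN * C * Real.exp (2 * δ)), hM₂, hδ, ha₀, lt_of_lt_of_le one_pos (le_max_left _ _),
    fun x hM α₀ hα₀ hMa U hU => ?_⟩
  obtain ⟨h0, h1⟩ := hmaj x hM α₀ hα₀ hMa U hU
  -- the ONE class read: `G`-valuedness, from the displayed `MemOfFam G R₁`
  have hUG : ∀ μ y, U μ y ∈ G := mem_of_reg335R hGR x hU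
  have hpar : ∀ z w : SiteY x.toKIdx, ‖((𝔏 x).parS U z w : Matrix (Fin N) (Fin N) ℂ)‖ ≤ 1 ∧
      ‖((((𝔏 x).parS U z w)⁻¹ : (Matrix (Fin N) (Fin N) ℂ)ˣ) : Matrix (Fin N) (Fin N) ℂ)‖ ≤ 1 :=
    fun z w => contractive_of_mem hG (hparG x U hUG z w)
  have hL := left342At_of_hasMajorants (κ := κ) x b (B := bg9YR (Matrix (Fin N) (Fin N) ℂ) G R₁ R₂ x) (fun U => U) (𝔏 x).Gp (𝔏 x).parS U
    (hlev x) (hβ1 x) (hnbr x) hpar hC hδ.le h0 h1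
  exact left342At_mono hL (le_max_right _ _)

/-- ★ **THE LEFT (3.42) SCHEMA AT THE CARRIER FROM ROW 18's LEAF ON THE `PairM` E-LETTER** (`𝔸 = M_N(ℂ)`, `G ≤ U(N)`, site transporters `G`-valued on
`G`-valued configurations, `hGR : MemOfFam G R₁`) — the R-twin of `B9Ineq349SiteFromPinsPairM.thm31LeftSchema_of_t37_pairM` (conclusion unfolded at the carrier).
[cite: Balaban1985BackgroundPropagators, Thm 3.1 (3.42) p.397 ⇐ Thm 3.7 p.410; (3.25) p.394, (3.35) p.396] -/
theorem thm31LeftSchemaR_of_t37_pairM (hG : G ≤ B7Prop2Explicit.unitaryUnits (Matrix (Fin N) (Fin N) ℂ)) (hGR : MemOfFam G R₁)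
    (b : Module.Basis κ ℝ (Matrix (Fin N) (Fin N) ℂ)) {c35 : ℝ} (𝔏 : ∀ x : MemberY d ℓ hd hL b₀ b₁ Mstar, CovLettersY (Matrix (Fin N) (Fin N) ℂ) x)
    (hparG : ∀ (x : MemberY d ℓ hd hL b₀ b₁ Mstar) (U : CfgY (Matrix (Fin N) (Fin N) ℂ) x.toKIdx), (∀ μ y, U μ y ∈ G) →
      ∀ z w : SiteY x.toKIdx, (𝔏 x).parS U z w ∈ G)
    {bI : ∀ x : MemberY d ℓ hd hL b₀ b₁ Mstar, FBondY x.toKIdx → IBondY x.toKIdx}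
    (hlev : ∀ (x : MemberY d ℓ hd hL b₀ b₁ Mstar) (f : FBondY x.toKIdx), lvl x.hN x.D x.hk (bI x f) = (blkV1 x.hN x.D f).1.1)
    (hβ1 : ∀ (x : MemberY d ℓ hd hL b₀ b₁ Mstar) (f : FBondY x.toKIdx), (B6Geom246MultiLevelTorus.geomT x.D).dist (β x.hN x.D x.hk (bI x f)) (blkV1 x.hN x.D f) ≤ 1)
    {mN : ℕ} (hnbr : ∀ (x : MemberY d ℓ hd hL b₀ b₁ Mstar) (y : (geo9Y x).Site), (nbr (geo9Y x) 2 y).card ≤ mN)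
    {ι : MemberY d ℓ hd hL b₀ b₁ Mstar → Type}
    (𝔬 : ∀ x : MemberY d ℓ hd hL b₀ b₁ Mstar, Ops (geo9Y x) (bg9YR (Matrix (Fin N) (Fin N) ℂ) G R₁ R₂ x) (XSK κ x.toKIdx) (XSK κ x.toKIdx) (ι x))
    (rd : ∀ x : MemberY d ℓ hd hL b₀ b₁ Mstar, WalkReading (geo9Y x) (bg9YR (Matrix (Fin N) (Fin N) ℂ) G R₁ R₂ x) (XSK κ x.toKIdx) (ι x))
    (H : MemberY d ℓ hd hL b₀ b₁ Mstar → Prop) {m mN' : ℕ} {Cev NQ : ℝ} {p q : PinPrims} (hp : p.OK) {p3 q3 : PairPrims} {pM qM : MixedPrims}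
    {K : ∀ x : MemberY d ℓ hd hL b₀ b₁ Mstar, B9.KernelFamily (geo9Y x) (bg9YR (Matrix (Fin N) (Fin N) ℂ) G R₁ R₂ x)}
    (t37 : B9.Thm37Printed c35 (fun x : MemberY d ℓ hd hL b₀ b₁ Mstar => geo9Y x) (fun x => bg9YR (Matrix (Fin N) (Fin N) ℂ) G R₁ R₂ x)
      (fun x => E37YPairM (bg := bg9YR (Matrix (Fin N) (Fin N) ℂ) G R₁ R₂) m mN' Cev NQ p q p3 q3 pM qM (𝔬 x) (rd x) (H x) (K x)))
    (hblkS : ∀ x : MemberY d ℓ hd hL b₀ b₁ Mstar, (𝔬 x).blk = blkSK x.toKIdx (sIK x.toKIdx (bI x)))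
    (hblkYS : ∀ x : MemberY d ℓ hd hL b₀ b₁ Mstar, (𝔬 x).blkY = blkSK x.toKIdx (sIK x.toKIdx (bI x)))
    (hGpS : ∀ (x : MemberY d ℓ hd hL b₀ b₁ Mstar) (U : (bg9YR (Matrix (Fin N) (Fin N) ℂ) G R₁ R₂ x).Cfg),
      (𝔬 x).Gp U = GcoS x.toKIdx b (bg9YR (Matrix (Fin N) (Fin N) ℂ) G R₁ R₂ x) (fun U => U) (𝔏 x).Gp U)
    (hDS : ∀ (x : MemberY d ℓ hd hL b₀ b₁ Mstar) (U : (bg9YR (Matrix (Fin N) (Fin N) ℂ) G R₁ R₂ x).Cfg),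
      (𝔬 x).D U = DcoS x.toKIdx b (bg9YR (Matrix (Fin N) (Fin N) ℂ) G R₁ R₂ x) (fun U => U) U) :
    ∃ M₁ δ₀ a₀ B₀ : ℝ, 0 < M₁ ∧ 0 < δ₀ ∧ 0 < a₀ ∧ 0 < B₀ ∧
      ∀ x : MemberY d ℓ hd hL b₀ b₁ Mstar, M₁ ≤ (geo9Y x).M → ∀ α₀ : ℝ, 0 < α₀ → (geo9Y x).M * α₀ ≤ a₀ →
        ∀ U : (bg9YR (Matrix (Fin N) (Fin N) ℂ) G R₁ R₂ x).Cfg, (bg9YR (Matrix (Fin N) (Fin N) ℂ) G R₁ R₂ x).Reg335 c35 α₀ U →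
          Left342At x.toKIdx (𝔏 x).parS (𝔏 x).Gp U B₀ δ₀ :=
  thm31LeftSchemaR_of_majorants R₁ R₂ hG hGR b 𝔏 hparG hlev hβ1 hnbr
    (majorants342_of_t37_pairM_R R₁ R₂ b 𝔏 𝔬 rd H hp t37 hblkS hblkYS hGpS hDS)

end Left

/-! ## §3 ★★ The symmetry ∕ transport conjuncts and the adjoint side at the carrier: `Thm31SiteSchemasR` -/

section Adjoint

variable {N : ℕ} {G : Subgroup (Matrix (Fin N) (Fin N) ℂ)ˣ}
variable {d ℓ : ℕ} {hd : 1 ≤ d + 1} {hL : Odd (ℓ + 1) ∧ 1 < ℓ + 1} {b₀ b₁ : ℝ} {Mstar : ℕ}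
variable (R₁ R₂ : RegFamY d ℓ hd hL b₀ b₁ Mstar (Matrix (Fin N) (Fin N) ℂ))

/-- ★ **`LEFT → LEFT-SYMM` AT THE CARRIER FOR ANY LETTERS FAMILY WITH THE STANDARD SITE TRANSPORTER AND SITE PROPAGATOR** (`(𝔏 x).parS = parSymY`,
`(𝔏 x).Gp = GpY … (parSymY …)`; `G ≤ U(N)`; `U` is `G`-valued on the carrier's (3.35) by `hGR : MemOfFam G R₁`): `G′(U)` is `trIP`-symmetric
(`isSymmTr_GpY_parSymY`) and `parSymY` is `G`-valued (`parSymY_mem`) — the R-twin of `B9Ineq349SiteFacesAtLetters.thm31LeftSchemaSymm_of_std` (both schemas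
unfolded at the carrier). [cite: Balaban1985BackgroundPropagators, (3.25) p.394, (3.35) p.396, (3.40) p.397] -/
theorem thm31LeftSchemaSymmR_of_std (hG : G ≤ B7Prop2Explicit.unitaryUnits (Matrix (Fin N) (Fin N) ℂ)) (hGR : MemOfFam G R₁)
    (𝔏 : ∀ x : MemberY d ℓ hd hL b₀ b₁ Mstar, CovLettersY (Matrix (Fin N) (Fin N) ℂ) x)
    (hparS : ∀ x : MemberY d ℓ hd hL b₀ b₁ Mstar, (𝔏 x).parS = parSymY x.toKIdx)
    (hGp : ∀ x : MemberY d ℓ hd hL b₀ b₁ Mstar, (𝔏 x).Gp = GpY x.toKIdx (parSymY x.toKIdx)) {c35 : ℝ}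
    (h : ∃ M₁ δ₀ a₀ B₀ : ℝ, 0 < M₁ ∧ 0 < δ₀ ∧ 0 < a₀ ∧ 0 < B₀ ∧
      ∀ x : MemberY d ℓ hd hL b₀ b₁ Mstar, M₁ ≤ (geo9Y x).M → ∀ α₀ : ℝ, 0 < α₀ → (geo9Y x).M * α₀ ≤ a₀ →
        ∀ U : (bg9YR (Matrix (Fin N) (Fin N) ℂ) G R₁ R₂ x).Cfg, (bg9YR (Matrix (Fin N) (Fin N) ℂ) G R₁ R₂ x).Reg335 c35 α₀ U →
          Left342At x.toKIdx (𝔏 x).parS (𝔏 x).Gp U B₀ δ₀) :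
    ∃ M₁ δ₀ a₀ B₀ : ℝ, 0 < M₁ ∧ 0 < δ₀ ∧ 0 < a₀ ∧ 0 < B₀ ∧
      ∀ x : MemberY d ℓ hd hL b₀ b₁ Mstar, M₁ ≤ (geo9Y x).M → ∀ α₀ : ℝ, 0 < α₀ → (geo9Y x).M * α₀ ≤ a₀ →
        ∀ U : (bg9YR (Matrix (Fin N) (Fin N) ℂ) G R₁ R₂ x).Cfg, (bg9YR (Matrix (Fin N) (Fin N) ℂ) G R₁ R₂ x).Reg335 c35 α₀ U →
          Left342At x.toKIdx (𝔏 x).parS (𝔏 x).Gp U B₀ δ₀ ∧ IsSymmTr (fun _ => (1 : ℝ)) ((𝔏 x).Gp U) ∧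
            ∀ z w : SiteY x.toKIdx, (𝔏 x).parS U z w ∈ G := by
  obtain ⟨M₁, δ₀, a₀, B₀, hM₁, hδ₀, ha₀, hB₀, H⟩ := h
  refine ⟨M₁, δ₀, a₀, B₀, hM₁, hδ₀, ha₀, hB₀, fun x hM α₀ hα₀ hMa U hU => ⟨H x hM α₀ hα₀ hMa U hU, ?_, ?_⟩⟩
  · have hUG : ∀ μ y, U μ y ∈ G := mem_of_reg335R hGR x hU
    rw [hGp x]
    exact isSymmTr_GpY_parSymY x.toKIdx hG hUG
  · intro z w
    rw [hparS x]
    exact parSymY_mem x.toKIdx (mem_of_reg335R hGR x hU) z w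

/-- ★★ **`Thm31SiteSchemasR` FROM THE LEFT-SYMM SCHEMA AT THE CARRIER** (`G ≤ U(N)`; `U` is `G`-valued on the carrier's (3.35) by `hGR : MemOfFam G R₁`):
constant `max 1 N · B₀`, the adjoint side by `right342At_of_left342At` — the R-twin of `B9Ineq349SiteAdjoint.thm31SiteSchemas_of_left` (same proof text; the
LEFT-SYMM hypothesis unfolded at the carrier). [cite: Balaban1985BackgroundPropagators, Thm 3.1 (3.42) p.397, (3.25) p.394, (3.35) p.396] -/
theorem thm31SiteSchemasR_of_leftSymm (hG : G ≤ B7Prop2Explicit.unitaryUnits (Matrix (Fin N) (Fin N) ℂ)) (hGR : MemOfFam G R₁) {c35 : ℝ}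
    (𝔏 : ∀ x : MemberY d ℓ hd hL b₀ b₁ Mstar, CovLettersY (Matrix (Fin N) (Fin N) ℂ) x)
    (h : ∃ M₁ δ₀ a₀ B₀ : ℝ, 0 < M₁ ∧ 0 < δ₀ ∧ 0 < a₀ ∧ 0 < B₀ ∧
      ∀ x : MemberY d ℓ hd hL b₀ b₁ Mstar, M₁ ≤ (geo9Y x).M → ∀ α₀ : ℝ, 0 < α₀ → (geo9Y x).M * α₀ ≤ a₀ →
        ∀ U : (bg9YR (Matrix (Fin N) (Fin N) ℂ) G R₁ R₂ x).Cfg, (bg9YR (Matrix (Fin N) (Fin N) ℂ) G R₁ R₂ x).Reg335 c35 α₀ U →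
          Left342At x.toKIdx (𝔏 x).parS (𝔏 x).Gp U B₀ δ₀ ∧ IsSymmTr (fun _ => (1 : ℝ)) ((𝔏 x).Gp U) ∧
            ∀ z w : SiteY x.toKIdx, (𝔏 x).parS U z w ∈ G) :
    Thm31SiteSchemasR (Matrix (Fin N) (Fin N) ℂ) G c35 𝔏 R₁ R₂ := by
  obtain ⟨M₁, δ₀, a₀, B₀, hM₁, hδ₀, ha₀, hB₀, H⟩ := h
  refine ⟨M₁, δ₀, a₀, max 1 (N : ℝ) * B₀, hM₁, hδ₀, ha₀, by positivity, fun x hM α₀ hα₀ hMa U hU => ?_⟩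
  obtain ⟨hLe, hsymm, hparG⟩ := H x hM α₀ hα₀ hMa U hU
  -- the ONE class read: `G`-valuedness, from the displayed `MemOfFam G R₁`
  have hUG : ∀ μ y, U μ y ∈ G := mem_of_reg335R hGR x hU
  have hUu : ∀ μ y, (U μ y : Matrix (Fin N) (Fin N) ℂ) ∈ unitary (Matrix (Fin N) (Fin N) ℂ) := fun μ y => hG (hUG μ y)
  have hparu : ∀ (s : BlkY x.toKIdx) (z : SiteY x.toKIdx),
      ((𝔏 x).parS U (blkCornerY x.toKIdx s) z : Matrix (Fin N) (Fin N) ℂ) ∈ unitary (Matrix (Fin N) (Fin N) ℂ) :=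
    fun s z => hG (hparG _ z)
  have hR := right342At_of_left342At x.toKIdx hUu hparu hsymm hB₀.le hLe
  -- monotonicity of both schemas in the constant: `B₀, N·B₀ ≤ max 1 N · B₀`
  have hle₁ : B₀ ≤ max 1 (N : ℝ) * B₀ := by nlinarith [le_max_left (1 : ℝ) N]
  have hle₂ : (N : ℝ) * B₀ ≤ max 1 (N : ℝ) * B₀ := mul_le_mul_of_nonneg_right (le_max_right _ _) hB₀.le
  refine ⟨fun s s₁ F hF z hz => ⟨?_, fun μ => ?_⟩, fun s₂ s' x' hx' E hE => ⟨?_, fun ν => ?_⟩⟩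
  · exact (hLe s s₁ F hF z hz).1.trans (by
      have := (lenB_pos x.toKIdx s).le
      exact mul_le_mul_of_nonneg_right (mul_le_mul_of_nonneg_right hle₁ (pow_nonneg this 2)) (Real.exp_nonneg _))
  · exact ((hLe s s₁ F hF z hz).2 μ).trans (by
      have := (lenB_pos x.toKIdx s).le
      exact mul_le_mul_of_nonneg_right (mul_le_mul_of_nonneg_right hle₁ this) (Real.exp_nonneg _))
  · exact (hR s₂ s' x' hx' E hE).1.trans (by
      have := (lenB_pos x.toKIdx s').le
      exact mul_le_mul_of_nonneg_right (mul_le_mul_of_nonneg_right hle₂ (pow_nonneg this 2)) (Real.exp_nonneg _))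
  · exact ((hR s₂ s' x' hx' E hE).2 ν).trans (by
      have := (lenB_pos x.toKIdx s').le
      exact mul_le_mul_of_nonneg_right (mul_le_mul_of_nonneg_right hle₂ this) (Real.exp_nonneg _))

end Adjoint

/-! ## §4 The (3.48) schema of (3.49) at the carrier: from Theorem 3.9's majorant (class-blind), from ROWS 15–16's one display -/

section Blk

variable {𝔸 : Type} [NormedRing 𝔸] [NormedAlgebra ℂ 𝔸] [CompleteSpace 𝔸] [FiniteDimensional ℂ 𝔸] {G : Subgroup 𝔸ˣ}
variable {d ℓ : ℕ} {hd : 1 ≤ d + 1} {hL : Odd (ℓ + 1) ∧ 1 < ℓ + 1} {b₀ b₁ : ℝ} {Mstar : ℕ}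
variable (R₁ R₂ : RegFamY d ℓ hd hL b₀ b₁ Mstar 𝔸)

/-- ★ **`Thm32BlkSchemaR` FROM THE BLOCK MAJORANTS AT THE FAITHFUL PINS, AT THE CLASS-PARAMETRIC CARRIER** (any finite-dimensional `𝔸`, any `G`; class-blind) —
the R-twin of `B9Ineq349SiteFromConv348.thm32BlkSchema_of_majorants`: under Theorem 3.9's prefix at the carrier a two-sided inverse of `L39 (𝔏 x).parS (𝔏 x).Gp U`
with the majorant `B₁(Lʲη)⁻⁴e^{−δ₁d}` w.r.t. `blk39F (bI x)` gives `Thm32BlkSchemaR 𝔸 G c35 𝔏 R₁ R₂`, `B₁′ = max(1, cR39·|κ39|·B₁·e^{2δ₁})`.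
[cite: Balaban1985BackgroundPropagators, Thm 3.2 (3.48) p.398 ⇐ Thm 3.9 p.413; (3.35) p.396 (the class as a parameter)] -/
theorem thm32BlkSchemaR_of_majorants [∀ x : MemberY d ℓ hd hL b₀ b₁ Mstar, Fintype (geo9Y x).Site] {c35 : ℝ}
    (𝔏 : ∀ x : MemberY d ℓ hd hL b₀ b₁ Mstar, CovLettersY 𝔸 x) {bI : ∀ x : MemberY d ℓ hd hL b₀ b₁ Mstar, FBondY x.toKIdx → IBondY x.toKIdx}
    (hlev : ∀ (x : MemberY d ℓ hd hL b₀ b₁ Mstar) (f : FBondY x.toKIdx), lvl x.hN x.D x.hk (bI x f) = (blkV1 x.hN x.D f).1.1)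
    (hβ1 : ∀ (x : MemberY d ℓ hd hL b₀ b₁ Mstar) (f : FBondY x.toKIdx), (B6Geom246MultiLevelTorus.geomT x.D).dist (β x.hN x.D x.hk (bI x f)) (blkV1 x.hN x.D f) ≤ 1)
    {R : MemberY d ℓ hd hL b₀ b₁ Mstar → ℝ} {H : MemberY d ℓ hd hL b₀ b₁ Mstar → Prop}
    (h : ∃ M₂ a₀ B₁ δ₁ : ℝ, 0 < M₂ ∧ 0 < a₀ ∧ 0 ≤ B₁ ∧ 0 < δ₁ ∧
      ∀ x : MemberY d ℓ hd hL b₀ b₁ Mstar, M₂ ≤ (geo9Y x).M → ∀ α₀ : ℝ, 0 < α₀ → (geo9Y x).M * α₀ ≤ a₀ →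
        ∀ U : (bg9YR 𝔸 G R₁ R₂ x).Cfg, (bg9YR 𝔸 G R₁ R₂ x).Reg335 c35 α₀ U →
          ∃ T : Module.End ℝ (X39 𝔸 x.toKIdx → ℝ), T * L39 x.toKIdx (𝔏 x).parS (𝔏 x).Gp U = 1 ∧ L39 x.toKIdx (𝔏 x).parS (𝔏 x).Gp U * T = 1 ∧
            HasMajorant (g := toB6 (geo9Y x) (R x) (H x)) (blk39F 𝔸 x.toKIdx (bI x)) T
              (fun a a' => B₁ * (geo9Y x).len a ^ (-(4 : ℝ)) * Real.exp (-(δ₁ * (geo9Y x).dist a a')))) :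
    Thm32BlkSchemaR 𝔸 G c35 𝔏 R₁ R₂ := by
  obtain ⟨M₂, a₀, B₁, δ₁, hM₂, ha₀, hB, hδ, hmaj⟩ := h
  refine ⟨M₂, δ₁, a₀, max 1 (cR39 (basis39 𝔸) * Fintype.card (κ39 𝔸) * B₁ * Real.exp (2 * δ₁)), hM₂, hδ, ha₀,
    lt_of_lt_of_le one_pos (le_max_left _ _), fun x hM α₀ hα₀ hMa U hU => ?_⟩
  obtain ⟨T, hTL, hLT, hm⟩ := hmaj x hM α₀ hα₀ hMa U hU
  exact blk348At_mono (blk348At_of_hasMajorant x (𝔏 x).parS (𝔏 x).Gp U (hlev x) (hβ1 x) hB hδ.le T hTL hLT hm) (le_max_right _ _)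

end Blk

section Display348

variable {N : ℕ} (θ : Stage3Params) (Mstar : ℕ) (𝔏 : LettersY N θ Mstar)
variable (R₁ R₂ : RegFamY θ.d₆ θ.ℓ₆ θ.hd' θ.hL' θ.b₀ θ.b₁ Mstar (Matrix (Fin N) (Fin N) ℂ))
variable [∀ x : MemberY θ.d₆ θ.ℓ₆ θ.hd' θ.hL' θ.b₀ θ.b₁ Mstar, Fintype (geo9Y x).Site]
variable (bI : ∀ x : MemberY θ.d₆ θ.ℓ₆ θ.hd' θ.hL' θ.b₀ θ.b₁ Mstar, FBondY x.toKIdx → IBondY x.toKIdx)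

/-- **ROWS 15–16's ONE DISPLAY AT THE CARRIER, RE-THRESHOLDED** — the R-twin of `B9Ineq349SiteFromPinsPairM.majorants348_of_display348`: `Conv348Blk` of the one-cube
letters on the faithful block map (premised on the carrier's (3.35)) IS a two-sided inverse of `L39 (𝔏 x).parS (𝔏 x).Gp U` with the block majorant
`B₁(Lʲη)⁻⁴e^{−δ₁d}` w.r.t. `blk39F (bI x)`; `c35·M·α₀ ≤ a₁` becomes `M·α₀ ≤ a₁∕c35` (`0 < c35`).
[cite: Balaban1985BackgroundPropagators, Thm 3.2 (3.48) p.398 + (3.96) p.411, (3.35) p.396; Balaban1984PropagatorsII, (2.51) p.232] -/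
theorem majorants348_of_display348_R {c35 : ℝ} (hc : 0 < c35) {B₁ δ₁ a₁ M₁ : ℝ} (hB : 0 ≤ B₁) (hδ : 0 < δ₁) (ha₁ : 0 < a₁) (hM₁ : 0 < M₁)
    (h348 : ∀ x : MemberY θ.d₆ θ.ℓ₆ θ.hd' θ.hL' θ.b₀ θ.b₁ Mstar, M₁ ≤ (geo9Y x).M → ∀ α₀ : ℝ, 0 < α₀ → c35 * (geo9Y x).M * α₀ ≤ a₁ →
      ∀ U : (bg9YR (Matrix (Fin N) (Fin N) ℂ) (specialUnitaryUnits (Fin N)) R₁ R₂ x).Cfg,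
        (bg9YR (Matrix (Fin N) (Fin N) ℂ) (specialUnitaryUnits (Fin N)) R₁ R₂ x).Reg335 c35 α₀ U → Conv348Blk (oneCubeOps39YF θ Mstar 𝔏 bI x) B₁ δ₁ U) :
    ∃ M₂ a₀ B₁ δ₁ : ℝ, 0 < M₂ ∧ 0 < a₀ ∧ 0 ≤ B₁ ∧ 0 < δ₁ ∧
      ∀ x : MemberY θ.d₆ θ.ℓ₆ θ.hd' θ.hL' θ.b₀ θ.b₁ Mstar, M₂ ≤ (geo9Y x).M → ∀ α₀ : ℝ, 0 < α₀ → (geo9Y x).M * α₀ ≤ a₀ →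
        ∀ U : (bg9YR (Matrix (Fin N) (Fin N) ℂ) (specialUnitaryUnits (Fin N)) R₁ R₂ x).Cfg,
          (bg9YR (Matrix (Fin N) (Fin N) ℂ) (specialUnitaryUnits (Fin N)) R₁ R₂ x).Reg335 c35 α₀ U →
          ∃ T : Module.End ℝ (X39 (Matrix (Fin N) (Fin N) ℂ) x.toKIdx → ℝ),
            T * L39 x.toKIdx (𝔏 x).parS (𝔏 x).Gp U = 1 ∧ L39 x.toKIdx (𝔏 x).parS (𝔏 x).Gp U * T = 1 ∧
            HasMajorant (g := toB6 (geo9Y x) 0 True) (blk39F (Matrix (Fin N) (Fin N) ℂ) x.toKIdx (bI x)) T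
              (fun a a' => B₁ * (geo9Y x).len a ^ (-(4 : ℝ)) * Real.exp (-(δ₁ * (geo9Y x).dist a a'))) := by
  refine ⟨M₁, a₁ / c35, B₁, δ₁, hM₁, div_pos ha₁ hc, hB, hδ, fun x hM α₀ hα₀ hMa U hU => ?_⟩
  have hMa' : c35 * (geo9Y x).M * α₀ ≤ a₁ := by
    rw [mul_assoc]
    calc c35 * ((geo9Y x).M * α₀) ≤ c35 * (a₁ / c35) := mul_le_mul_of_nonneg_left hMa hc.le
      _ = a₁ := mul_div_cancel₀ a₁ hc.ne'
  obtain ⟨T, hTL, hLT, hm⟩ := h348 x hM α₀ hα₀ hMa' U hU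
  exact ⟨T, hTL, hLT, hm⟩

/-- ★★ **THE R-CERTIFICATE's ROW-25 INPUT `Thm32BlkSchemaR` FROM ROWS 15–16's ONE DISPLAY AT THE CARRIER** — the R-twin of
`B9Ineq349SiteFromPinsPairM.thm32BlkSchema_of_display348` (`h348` premised on the carrier's (3.35); faithfulness of `bI`; class-blind).
[cite: Balaban1985BackgroundPropagators, Thm 3.2 (3.48) p.398 ⇐ Thm 3.9 p.413 + (3.96) p.411, (3.35) p.396; Balaban1984PropagatorsII, (2.51) p.232, (2.45) p.231] -/
theorem thm32BlkSchemaR_of_display348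
    (hlev : ∀ (x : MemberY θ.d₆ θ.ℓ₆ θ.hd' θ.hL' θ.b₀ θ.b₁ Mstar) (f : FBondY x.toKIdx), lvl x.hN x.D x.hk (bI x f) = (blkV1 x.hN x.D f).1.1)
    (hβ1 : ∀ (x : MemberY θ.d₆ θ.ℓ₆ θ.hd' θ.hL' θ.b₀ θ.b₁ Mstar) (f : FBondY x.toKIdx),
      (B6Geom246MultiLevelTorus.geomT x.D).dist (β x.hN x.D x.hk (bI x f)) (blkV1 x.hN x.D f) ≤ 1)
    {c35 : ℝ} (hc : 0 < c35) {B₁ δ₁ a₁ M₁ : ℝ} (hB : 0 ≤ B₁) (hδ : 0 < δ₁) (ha₁ : 0 < a₁) (hM₁ : 0 < M₁)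
    (h348 : ∀ x : MemberY θ.d₆ θ.ℓ₆ θ.hd' θ.hL' θ.b₀ θ.b₁ Mstar, M₁ ≤ (geo9Y x).M → ∀ α₀ : ℝ, 0 < α₀ → c35 * (geo9Y x).M * α₀ ≤ a₁ →
      ∀ U : (bg9YR (Matrix (Fin N) (Fin N) ℂ) (specialUnitaryUnits (Fin N)) R₁ R₂ x).Cfg,
        (bg9YR (Matrix (Fin N) (Fin N) ℂ) (specialUnitaryUnits (Fin N)) R₁ R₂ x).Reg335 c35 α₀ U → Conv348Blk (oneCubeOps39YF θ Mstar 𝔏 bI x) B₁ δ₁ U) :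
    Thm32BlkSchemaR (Matrix (Fin N) (Fin N) ℂ) (specialUnitaryUnits (Fin N)) c35 𝔏 R₁ R₂ :=
  thm32BlkSchemaR_of_majorants R₁ R₂ 𝔏 hlev hβ1 (majorants348_of_display348_R θ Mstar 𝔏 R₁ R₂ bI hc hB hδ ha₁ hM₁ h348)

end Display348

end Literature.MathematicalPhysics.QuantumFieldTheory.Balaban1983to89.B9Ineq349SiteSchemasR

end
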